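import Mathlib.NumberTheory.Chebyshev
import Mathlib.Topology.Algebra.InfiniteSum.Real
import HarnessLib

/-!
# Type-I Hermite–Padé forms for `1, Li₁(x), Li₂(x)` at `x = 1/N` — vocabulary

Topic `Literature/NumberTheory/DiophantineApproximation`. The classical type-I Hermite–Padé
(simultaneous "German polynomial") construction behind the linear independence over `ℚ` of
`1, Li₁(1/N) = −log(1 − 1/N), Li₂(1/N)` for large integers `N` (Nikišin 1979; Hata 1990;
David–Hirata-Kohno–Kawashima 2020, Thm 2.1 for every weight): with the rational kernel

  `R_n(t) = ∏_{j=1}^{2n} (t − j) / ∏_{i=0}^{n} (t + i)²`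

one puts `S_n(x) = ∑_{t ≥ 1} R_n(t) x^t`. The numerator kills the first `2n` Taylor coefficients,
so `0 < S_n(1/N) ≤ N^{−2n}`, while the partial fraction expansion
`R_n(t) = ∑_i (A_{n,i}/(t+i)² + B_{n,i}/(t+i))` exhibits `S_n(1/N)` as
`a_n Li₂(1/N) + b_n Li₁(1/N) + c_n` with `a_n ∈ ℤ` and `lcm(1..3n)·lcm(1..n)² · (b_n, c_n) ∈ ℤ²`.

This file only fixes the VOCABULARY (definitions, no facts): the integer coefficients
`coefA n i = C(2n+i,i) C(2n,n) C(n,i)²`, the harmonic-type sums `harm n i`, `coefB = −coefA·harm`,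
the kernel `kernel n t` (numerator `num`, denominator `den`), the polylogarithm-type series
`polylogSeries s x = ∑_{k≥1} x^k/k^s`, the form `form n x`, its three coefficients
`formA`, `formB`, `formC` at `x = 1/N`, and the common denominator
`denom n = lcm(1..3n)·lcm(1..n)²` (Mathlib's `Nat.lcmUpto`). The partial fractions, the
series identity, the bounds and the independence theorem are proved in the sibling files
`DilogHermitePade*.lean` / `DilogLinearIndependence.lean`.

References: E. M. Nikišin, *On irrationality of the values of the functions F(x,s)*, Mat. Sb. 109
(1979); M. Hata, *On the linear independence of the values of polylogarithmic functions*, J. Math.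
Pures Appl. 69 (1990); S. David, N. Hirata-Kohno, M. Kawashima, *Can polylogarithms at algebraic
points be linearly independent?*, Moscow J. Comb. Number Th. 9 (2020), Thm 2.1.
-/

noncomputable section

open Finset

namespace Literature.NumberTheory.DiophantineApproximation

namespace DilogPade

/-- The integer residue coefficients of the type-I Hermite–Padé kernel at its double poles:
`A_{n,i} = C(2n+i, i)·C(2n, n)·C(n, i)² = ∏_{j=1}^{2n}(i + j) / (i!·(n−i)!)²`.
[cite: DavidHirataKohnoKawashima2020, Thm 2.1] -/
def coefA (n i : ℕ) : ℕ := (2 * n + i).choose i * (2 * n).choose n * (n.choose i) ^ 2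

/-- The harmonic-type sum `H_{n,i} = ∑_{j=1}^{2n} 1/(i+j) + 2·∑_{0 ≤ l ≤ n, l ≠ i} 1/(l − i)`
(the logarithmic derivatives of numerator and denominator of the kernel at the pole `t = −i`).
[cite: DavidHirataKohnoKawashima2020, Thm 2.1] -/
def harm (n i : ℕ) : ℚ :=
  (∑ j ∈ range (2 * n), (1 : ℚ) / ((i : ℚ) + j + 1)) +
    2 * ∑ l ∈ (range (n + 1)).filter (· ≠ i), (1 : ℚ) / ((l : ℚ) - i)

/-- The rational residue coefficients at the simple parts of the double poles:
`B_{n,i} = −A_{n,i}·H_{n,i}`. [cite: DavidHirataKohnoKawashima2020, Thm 2.1] -/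
def coefB (n i : ℕ) : ℚ := -((coefA n i : ℚ) * harm n i)

/-- The numerator of the kernel, `∏_{j=1}^{2n} (t − j)` (a real polynomial function of `t`,
vanishing at `t = 1, …, 2n`). [cite: DavidHirataKohnoKawashima2020, Thm 2.1] -/
def num (n : ℕ) (t : ℝ) : ℝ := ∏ j ∈ range (2 * n), (t - ((j : ℝ) + 1))

/-- The denominator of the kernel, `∏_{i=0}^{n} (t + i)²`.
[cite: DavidHirataKohnoKawashima2020, Thm 2.1] -/
def den (n : ℕ) (t : ℝ) : ℝ := ∏ i ∈ range (n + 1), (t + (i : ℝ)) ^ 2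

/-- The type-I Hermite–Padé kernel `R_n(t) = ∏_{j=1}^{2n} (t − j) / ∏_{i=0}^{n} (t + i)²`
(Mathlib's junk value `x/0 = 0` at the poles `t = 0, −1, …, −n`, never used).
[cite: DavidHirataKohnoKawashima2020, Thm 2.1] -/
def kernel (n : ℕ) (t : ℝ) : ℝ := num n t / den n t

/-- The polylogarithm-type series `L_s(x) = ∑_{k ≥ 1} x^k / k^s` (as a `tsum` over `k : ℕ` of
`x^{k+1}/(k+1)^s`; for `|x| < 1` it converges absolutely; `L_1(x) = −log(1 − x)`, `L_2 = Li₂`).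
[folklore] -/
def polylogSeries (s : ℕ) (x : ℝ) : ℝ := ∑' k : ℕ, x ^ (k + 1) / ((k : ℝ) + 1) ^ s

/-- The Hermite–Padé form `S_n(x) = ∑_{t ≥ 1} R_n(t) x^t` (as a `tsum` over `t : ℕ` of
`R_n(t+1) x^{t+1}`; absolutely convergent for `|x| < 1` since `|R_n(t)| ≤ 1` for integers `t ≥ 1`).
[cite: DavidHirataKohnoKawashima2020, Thm 2.1] -/
def form (n : ℕ) (x : ℝ) : ℝ := ∑' t : ℕ, kernel n ((t : ℝ) + 1) * x ^ (t + 1)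

/-- The coefficient of `Li₂(1/N)` in `S_n(1/N)`: `a_n = ∑_{i=0}^{n} A_{n,i} N^i ∈ ℤ`.
[cite: DavidHirataKohnoKawashima2020, Thm 2.1] -/
def formA (n N : ℕ) : ℤ := ∑ i ∈ range (n + 1), (coefA n i : ℤ) * (N : ℤ) ^ i

/-- The coefficient of `Li₁(1/N)` in `S_n(1/N)`: `b_n = ∑_{i=0}^{n} B_{n,i} N^i ∈ ℚ`.
[cite: DavidHirataKohnoKawashima2020, Thm 2.1] -/
def formB (n N : ℕ) : ℚ := ∑ i ∈ range (n + 1), coefB n i * (N : ℚ) ^ i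

/-- The constant term of `S_n(1/N)`:
`c_n = −∑_{i=0}^{n} ∑_{k=0}^{i−1} N^k·(A_{n,i}/(i − k)² + B_{n,i}/(i − k)) ∈ ℚ`
(from `∑_{t≥1} N^{−t}/(t+i)^s = N^i (L_s(1/N) − ∑_{m=1}^{i} N^{−m}/m^s)`, `m = i − k`).
[cite: DavidHirataKohnoKawashima2020, Thm 2.1] -/
def formC (n N : ℕ) : ℚ :=
  -∑ i ∈ range (n + 1), ∑ k ∈ range i,
    (N : ℚ) ^ k * ((coefA n i : ℚ) / ((i : ℚ) - k) ^ 2 + coefB n i / ((i : ℚ) - k))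

/-- The common denominator `D_n = lcm(1, …, 3n) · lcm(1, …, n)²` of `b_n` and `c_n`
(`Nat.lcmUpto m = lcm(1..m)`, in Mathlib's `NumberTheory.Chebyshev`, whose logarithm is Chebyshev's `ψ(m)`). [folklore] -/
def denom (n : ℕ) : ℕ := Nat.lcmUpto (3 * n) * Nat.lcmUpto n ^ 2

/-- The common denominator is positive. [folklore] -/
theorem denom_pos (n : ℕ) : 0 < denom n :=
  Nat.mul_pos (Nat.lcmUpto_pos _) (pow_pos (Nat.lcmUpto_pos _) 2)

/-- The integer coefficients `A_{n,i}` are positive for `i ≤ n`. [folklore] -/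
theorem coefA_pos {n i : ℕ} (hi : i ≤ n) : 0 < coefA n i :=
  Nat.mul_pos (Nat.mul_pos (Nat.choose_pos (Nat.le_add_left i (2 * n))) (Nat.choose_pos (by omega)))
    (pow_pos (Nat.choose_pos hi) 2)

end DilogPade

end Literature.NumberTheory.DiophantineApproximation
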